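import Summits.ResolutionOfSingularities.ResolutionOfSingularities.Theorems.EquisingularLiftEquisingularLiftNatBadLocus
import Summits.ResolutionOfSingularities.ResolutionOfSingularities.Theorems.EquisingularLiftEquisingularLiftGoodAtOfRegularFibre
import HarnessLib

/-!
# [OURS · L1 W4.5(b) · EL♮ necessity kit] NO SHADOW THROUGH A BAD POINT IS REGULAR THERE
# (crux `EquisingularLiftNat` = stmt-ResolutionOfSingularities-20038; res-L1-w45b-strat-1 STRATEGY-CENSUS v8 §2 (T1)(c), handed to this lane by R2)

HONEST FRAMING. OURS (cell res-hironaka, crux chain w45b, slot W4.5(b)); NOT a statement of any manuscript; replaces the role of NOTHING in the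
manuscript; AI-written, AI review is weaker than expert review. Helper `--supports stmt-ResolutionOfSingularities-20038 --as helper` by
res-L1-w45b-lead-1. No `sorry`; standard axioms.

WHAT. The SHADOW CALCULUS of STRATEGY-CENSUS v8 (T1): the special fibre of a horizontal centre `C` at a point `c` is `𝒪_{C,c}/ϖ`. Item (c):
at a BAD point `y` of the ambient `X → Spec O` (the germ of a uniformiser lies in `𝔪_y²`), NO `Z → X` that is regular at a point `c` over
`y` and on which `ϖ` does not vanish identically near `c` (e.g. `Z` flat over `O`) has regular special fibre at the point over `c`:
badness persists to `Z` (`varpiGerm_mem_sq_of_over`, p530616), and a regular `𝒪_{Z,c}` with `0 ≠ ϖ ∈ 𝔪²` has the non-regular quotient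
`𝒪_{Z,c}/ϖ` (Matsumura 14.2, in the tree as `goodAt_of_isRegularLocalRing_fibre`, read contrapositively).
* `varpiGerm_ne_zero_of_flat` — over a domain `O`, a morphism `r : Z → Spec O` that is FLAT has non-zero germ of every non-zero `ϖ ∈ O` at
  every point (flat stalk maps out of the domain `𝒪_{Spec O, r c}` are injective on it).
* `exists_not_isRegularLocalRing_fibre_of_bad` — (T1)(c): `Z → X → Spec O`, `𝒪_{Z,c}` regular, the germs of the uniformisers non-zero at
  `c`, the ambient bad at the image of `c` ⇒ some point of the special fibre `Z ×_{Spec O} Spec κ` over `c` has NON-regular local ring.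
* `exists_not_isRegularLocalRing_fibre_of_bad_of_flat` — the same for `Z` flat over `O` (horizontal regular centres of the item's chains).
Consequence for the refuter programme (strat-1 (N1)/(T1)): every E1 step whose centre passes through a bad point has a shadow SINGULAR at
that point (ramified multisections, singular abstract-hypersurface germs) — the only steps available at bad points are thick ones.

References: Theorems/EquisingularLiftEquisingularLiftNatBadLocus.lean (persistence), …GoodAtOfRegularFibre.lean (Matsumura 14.2 as `GoodAt`);
L/res-L1-w45b-strat-1/STRATEGY-CENSUS-v8.md §2 (T1), §4 (N1).
-/

set_option linter.dupNamespace false -- mandated namespace `Summit.<Summit>.<Problem>` of this single-conjunct summit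
set_option linter.overlappingInstances false -- signatures carry `[IsDomain O] [IsDiscreteValuationRing O]`

noncomputable section

open CategoryTheory CategoryTheory.Limits AlgebraicGeometry TopologicalSpace Topology IsLocalRing
open Summit.ResolutionOfSingularities.ResolutionOfSingularities.Theses.EquisingularLift.Split
open Summit.ResolutionOfSingularities.ResolutionOfSingularities.Cruxes.EquisingularLift.StrataSplit

namespace Summit.ResolutionOfSingularities.ResolutionOfSingularities.Cruxes.EquisingularLiftNat.Sections

/-! ## Flat over a domain: the germ of a non-zero base element is non-zero -/

/-- Over a domain `O`, a FLAT `r : Z → Spec O` has non-zero germ of every non-zero `ϖ ∈ O` at every point `c`: the germ is the image of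
the (non-zero) germ of `ϖ` in the domain `𝒪_{Spec O, r c}` under the flat local homomorphism `r_c^♯`, and flat modules over a domain are
torsion-free. [folklore] -/
theorem varpiGerm_ne_zero_of_flat {O : Type} [CommRing O] [IsDomain O] {Z : Scheme.{0}} (r : Z ⟶ Spec (.of O)) [Flat r]
    (c : Z) (ϖ : O) (hϖ : ϖ ≠ 0) :
    (Z.presheaf.Γgerm c).hom (r.appTop.hom ((Scheme.ΓSpecIso (.of O)).inv.hom ϖ)) ≠ 0 := by
  -- naturality: the germ at `c` is `r_c^♯` of the germ at `r c`
  have hnat := varpiGerm_comp (𝟙 (Spec (.of O))) r r (Category.comp_id r) c ϖ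
  simp only [Scheme.Hom.id_appTop, CommRingCat.hom_id, RingHom.id_apply] at hnat
  rw [hnat]
  -- the germ of `ϖ` at `r c` is non-zero in the domain `𝒪_{Spec O, r c}`
  haveI : IsDomain (CommRingCat.of O) := inferInstanceAs (IsDomain O)
  set a := ((Spec (.of O)).presheaf.Γgerm (r c)).hom ((Scheme.ΓSpecIso (.of O)).inv.hom ϖ) with ha
  have ha0 : a ≠ 0 := by
    intro h
    have hinj := AlgebraicGeometry.germ_injective_of_isIntegral (Spec (.of O)) (U := ⊤) (r c) trivial
    have h1 : (Scheme.ΓSpecIso (.of O)).inv.hom ϖ = 0 := hinj (h.trans (map_zero _).symm)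
    have h2 : ϖ = 0 := by
      have := congrArg (fun t => (Scheme.ΓSpecIso (.of O)).hom.hom t) h1
      simpa using this
    exact hϖ h2
  -- flatness of the stalk map: `a • 1 ≠ 0`
  have hflat : (r.stalkMap c).hom.Flat := Flat.stalkMap r c
  letI := (r.stalkMap c).hom.toAlgebra
  haveI : Module.Flat ((Spec (.of O)).presheaf.stalk (r c)) (Z.presheaf.stalk c) := hflat
  have hreg : IsSMulRegular (Z.presheaf.stalk c) a :=
    Module.Flat.isSMulRegular_of_nonZeroDivisors (mem_nonZeroDivisors_of_ne_zero ha0)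
  intro h0
  have h1 : a • (1 : Z.presheaf.stalk c) = a • (0 : Z.presheaf.stalk c) := by
    rw [smul_zero, Algebra.smul_def, mul_one]
    exact h0
  exact one_ne_zero (hreg h1)

/-! ## (T1)(c): no shadow through a bad point is regular there -/

/-- **NO SHADOW THROUGH A BAD POINT IS REGULAR THERE.** `Z —i→ X —r→ Spec O` (`O` a DVR), `c ∈ Z` with `𝒪_{Z,c}` regular and the germs at
`c` of the uniformisers of `O` non-zero (e.g. `Z` flat over `O`); if the ambient `X` is BAD at `i c` (the germ of some uniformiser lies in
`𝔪_{i c}²`), then some point of the special fibre `Z ×_{Spec O} Spec κ` lying over `c` has a NON-regular local ring. Proof: badness persists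
to `(Z, c)` along `i` (`not_goodAt_of_exists_bad_below`), while regularity of the whole fibre over `c` would give `GoodAt (i ≫ r) c`
(`goodAt_of_isRegularLocalRing_fibre`, Matsumura 14.2). [folklore; cite: Matsumura1987, Thm. 14.2] -/
theorem exists_not_isRegularLocalRing_fibre_of_bad (O : Type) [CommRing O] [IsDomain O] [IsDiscreteValuationRing O]
    {X Z : Scheme.{0}} (r : X ⟶ Spec (.of O)) (i : Z ⟶ X) (c : Z)
    (hreg : IsRegularLocalRing (Z.presheaf.stalk c))
    (hne : ∀ ϖ : O, Irreducible ϖ → (Z.presheaf.Γgerm c).hom ((i ≫ r).appTop.hom ((Scheme.ΓSpecIso (.of O)).inv.hom ϖ)) ≠ 0)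
    (hbad : ∃ ϖ : O, Irreducible ϖ ∧ (X.presheaf.Γgerm (i c)).hom (r.appTop.hom ((Scheme.ΓSpecIso (.of O)).inv.hom ϖ)) ∈
      (maximalIdeal (X.presheaf.stalk (i c))) ^ 2) :
    ∃ z : ↥(pullback (i ≫ r) (Spec.map (CommRingCat.ofHom (residue O)))),
      pullback.fst (i ≫ r) (Spec.map (CommRingCat.ofHom (residue O))) z = c ∧
      ¬ IsRegularLocalRing ((pullback (i ≫ r) (Spec.map (CommRingCat.ofHom (residue O)))).presheaf.stalk z) := by
  by_contra h
  push Not at h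
  exact not_goodAt_of_exists_bad_below r (i ≫ r) i rfl c hbad (goodAt_of_isRegularLocalRing_fibre O Z (i ≫ r) c hreg hne h)

/-- **(T1)(c) for `O`-flat `Z`** (the horizontal regular centres of the item's chains are `O`-flat): `Z —i→ X —r→ Spec O` with `i ≫ r`
flat, `𝒪_{Z,c}` regular, `X` bad at `i c` ⇒ the special fibre of `Z` is non-regular at some point over `c`. [folklore; cite: Matsumura1987, Thm. 14.2] -/
theorem exists_not_isRegularLocalRing_fibre_of_bad_of_flat (O : Type) [CommRing O] [IsDomain O] [IsDiscreteValuationRing O]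
    {X Z : Scheme.{0}} (r : X ⟶ Spec (.of O)) (i : Z ⟶ X) [Flat (i ≫ r)] (c : Z)
    (hreg : IsRegularLocalRing (Z.presheaf.stalk c))
    (hbad : ∃ ϖ : O, Irreducible ϖ ∧ (X.presheaf.Γgerm (i c)).hom (r.appTop.hom ((Scheme.ΓSpecIso (.of O)).inv.hom ϖ)) ∈
      (maximalIdeal (X.presheaf.stalk (i c))) ^ 2) :
    ∃ z : ↥(pullback (i ≫ r) (Spec.map (CommRingCat.ofHom (residue O)))),
      pullback.fst (i ≫ r) (Spec.map (CommRingCat.ofHom (residue O))) z = c ∧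
      ¬ IsRegularLocalRing ((pullback (i ≫ r) (Spec.map (CommRingCat.ofHom (residue O)))).presheaf.stalk z) :=
  exists_not_isRegularLocalRing_fibre_of_bad O r i c hreg (fun ϖ hϖ => varpiGerm_ne_zero_of_flat (i ≫ r) c ϖ hϖ.ne_zero) hbad

end Summit.ResolutionOfSingularities.ResolutionOfSingularities.Cruxes.EquisingularLiftNat.Sections

end
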